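import Summits.QuantumFields.BalabanUV.T4Continuum.Spine.NE1p.DressedSmallFieldLabelCountsMu
import Summits.QuantumFields.BalabanUV.T4Continuum.Spine.NE1p.DressedSmallFieldComponentInner

/-!
# T⁴ programme, spine estimate NE1′ (node O3b/H2) — ROAD P1's SOURCE-PENCIL TWINS OF THE FULLY COMPOSED (B3-count): THE μ-PART FOR
# CORES WHOSE OUTER LABELS CARRY ANCHORED COMPONENTS WITH N0u's INNER LABELS (`hinner` SUPPLIED BY S41.2 §1), AND THE SET-VALUED VARIANT

Cell `pub-balaban`, sub-cell `t4`, BINDER-OWNERS row NE1′; owner lineage t4-ne1p-p1 (PROVER seat P1, «RG-trajectory comparison …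
μ-uniformity through the printed small-field bounds»), generation 31 = the owner's open offer O-owner-g30-1 (`CLAIMS.log` 2026-08-20
l.21599) taken by the owner; ADDITIVE — imports the owner's N0x PART 2 `Spine/NE1p/DressedSmallFieldLabelCountsMu` (p236238 ✓✓) and
crew row S41 PART 2 `Spine/NE1p/DressedSmallFieldComponentInner` (leaf-01-g13, p235568 ✓✓; → S41 PART 1 `DressedSmallFieldComponentSets`
p235144 ✓✓) ONLY — both sit on N0w `DressedSmallFieldComponentCount`, no cycle; THEOREMS ONLY (0 def, 0 `def … : Prop`, 0 cite); nothing
of N0s–N0x ∕ S41 is restated — `muPart_locE_le_of_coresAt_pencil_outerLabels`, `muPart_locE_le_of_coresAt_pencil_components` (N0x P2),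
`memberSetSum_le_of_anchor` (S41.1 §2) and `innerSum_le_of_innerCount` (S41.2 §1) are used BY NAME, ONCE each per theorem.

WHY THIS FILE (road P1's sentence at the END of the (B3-count) chain).  After N0x ∕ N0y the source-pencil twins exist at EVERY resummation
index separately (families N0t; inner N0x∕N0y; outer N0x; components N0x) — but the crew's COMPOSED END S41.2
`attachedPart_locE_le_of_coresAt_pencil_components_inner` (N0w's components END with the components' inner counts SUPPLIED from N0u: the
𝐃-step, the Y₀∕P-step, the components∕{Z′_i}-step and the Z∖Z′₀-step as ONE kernel implication on the cell's two (2.11)-geometries) and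
S41.1's set-valued END (n ≥ 1 components determining one `Z′_i`, [Balaban1988RGII] p. 19 KIND) had NO μ-twin.  This file supplies them:
* §1 **`muPart_locE_le_of_coresAt_pencil_componentSets`** — N0x P2's `muPart_locE_le_of_coresAt_pencil_outerLabels` ONCE BY NAME with
  inner finsets `J Z′ :=` the NONEMPTY subsets of `(univ.filter (cl · = Z′)).sigma I`, weights `n Z′ T := Π_{j∈T} ε·m j.1 j.2` and
  `hmember := memberSetSum_le_of_anchor …` (S41.1 §2) — the μ-twin of S41.1's `attachedPart_locE_le_of_coresAt_pencil_componentSets`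
  (`hinner` DISPLAYED in N0u's SHAPE, generic inner index `ι₀`);
* §2 **`muPart_locE_le_of_coresAt_pencil_components_inner`** — N0x P2's `muPart_locE_le_of_coresAt_pencil_components` ONCE BY NAME with
  `I Z₀ :=` N0u's admissible labels `⟨W, (𝐃, P)⟩` WRITTEN OUT, `m :=` N0u's table-blind majorant `(Π_{Y∈𝐃} α₆e^{−δκd_k Y}e^{−R_k(d_k Y+5)})·
  (s²t)^{#P}`, `c₀ := Gk.c₁u_k − 5R_k`, `R₀ := R_k − Gk.c₁u_k` (`u_k := e^{R_k c₃₂}·s·e^{b₀t}`) and `hinner := innerSum_le_of_innerCount …`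
  (S41.2 §1) — the μ-twin of S41.2's `attachedPart_locE_le_of_coresAt_pencil_components_inner`;
* §3 **`muPart_locE_le_of_coresAt_pencil_componentSets_inner`** — §1 ONCE with the same plug-in — the μ-twin of S41.2's
  `attachedPart_locE_le_of_coresAt_pencil_componentSets_inner`.
WHAT IT SAYS (road P1, owner's reading; nothing re-labelled): in all three the source window (`μ₁`, `μ₀`, `sμ`) and the observable's
direction `v` occur ONLY in the class radius `hH`, the activity identity `hact`, the per-label amplitude `hAmp` (through the radius
`‖h₀‖ + μ₁‖v‖`) and the conclusion — NEVER in a count binder: for THE WHOLE (B3-count) composed as one implication, «μ enters (B3) through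
the amplitude ALONE» is kernel.  Binder census vs the S41 table-pencil ENDs = N0x P2's standard swap: MINUS [`w`, `ϱ`, `A₀`, `A₁`, `hA₀`,
`hA₁`, `hϱ`, `hϱA`] PLUS [`v`, `μ₁`, `μ₀`, `sμ`, `A`, `hA`, `h0`, `h01`, `hμ`]; N0v∕N0w's per-uncovered-cube weight `v : ℝ` is spelled `vW`,
N0w's `hA` is spelled `hA'` (as in N0x P2); everything else VERBATIM S41's; conclusions = N0s's μ-part shape
`≤ e ν c₁ K₀²·A·e^{−r₁ d(X₀)}·μ₀∕(μ₁ − μ₀)`.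
WHAT STAYS DISPLAYED (binders, by name; NOTHING instantiated on Bałaban's densities): the room, operator conditions, class radii; (B1b)'s
residue `terms`∕`emb`∕`hscale`∕`hact` and `hadm` (outer label `⟨W′, ⟨F, p⟩⟩` with, per member `Z′`, ONE anchored component carrying one
N0u label (§2) resp. a NONEMPTY SET of them (§1∕§3) — (B1b)∕(2.35) READING); N0u's `bondsOf`∕`hb₀` and (2.27)∘(2.32)-KIND link `hlinkk`
per component (§2∕§3); N0w's closure `cl`, anchor `anc`∕`hanchor`∕`hA'` and (2.36)-KIND transfer `htransfer`; N0v's (2.27)∘(2.37)-KIND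
link `hlink` and `hRR`; (B3-form) `hAmp` (p. 18's clause KIND at `C₃(E₀ + D₀)`, NOT asserted); the (2.29) clauses at both scales; the rate
bookkeeping `hκR`∕`hrate2` — (B5)-KIND arithmetic whose standing against print's δ, κ, κ₁, α₆, L, M is NOT asserted.  On pv22's nested
tori the links ∕ transfer ∕ anchor are crew rows S40∕S43∕S44's (composable by name, not imported here).

PRINTED LOCI (TYPE∕CONTEXT only — [Balaban1988RGII] = T. Bałaban, Renormalization group approach to lattice gauge field theories. II,
Commun. Math. Phys. 116 (1988) 1–22; renders `b2b-balaban-ref1/pages/1988-cmp116-rg-II-cluster/…-p017…p020-x2.png` read as images by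
the owner g30, quoted in `HOME/b2b-balaban-t4-ne1p-p1/g30/OWNER-ANSWERS-g30.md` §2 (S17)–(S21), VERIFIED 7∕7 by t4-ref2 pass 86
C-t4r2-407): p. 17 «we bound the sums using the factors on the right-hand side of (2.26)»; p. 18 (2.27)–(2.29), «|P| ≥ ½M⁻⁴|Z₀∖Y₀|»,
(2.32); p. 19 (2.35)∕(2.36), «A sum over n components is estimated by a product of n sums»; p. 20 (2.37), C₃, Lemma 3 (2.38).  The
μ-extension (observable-attached table, source pencil) is the cell's, UNPRINTED (p. 356 of [Balaban1989LargeFieldII] defers observables).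
Nothing here is used as a fact about Bałaban's densities.

HONEST FRAMING.  By-name composition over SHAPES; cores ∕ labels are the cell's typed FORMAT of (2.14), NOT Bałaban's functions; `G`∕`Gk`
are `Geometry` HYPOTHESIS structures; nothing of (B1b)∕(B3) is discharged on Bałaban's densities; 0 binders instantiated on Bałaban's
(2.14) data; wall v1.8 (T4-DAG v48 — words, not kind) does NOT move; R-t4r2-Q2 NOT met thereby; NE1′ ⇐ the named binders — NOT printed,
NOT proved; spine PROVED 0∕9; count 9 unchanged.  ABSOLUTE RULE honoured: printed loci are TYPE∕CONTEXT only; nothing internally minted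
is cited; [folklore] tags on kernel theorems only.  Rung (B)+1 on ONE finite four-torus of fixed physical size — NOT infinite volume, NOT
a mass gap, NOT OS on ℝ⁴, NOT Clay.  HONEST DEPENDENCY: continuum YM on T⁴ ⇐ BetaPertH ∧ nine spine estimates (0/9 proved); BetaPertH
⇐ (D1) ∧ (D4) ∧ CAP+tail; G-an2-4 gates asym, D1 and NE2/3/4. -/

noncomputable section

namespace Summit.QuantumFields.BalabanUV.T4Continuum.NE1p.DressedSmallFieldComponentInnerMu

open Metric Set Complex MeasureTheory
open scoped BigOperators
open Literature.MathematicalPhysics.QuantumFieldTheory.Balaban1983to89 (LocDomainSys)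
open Literature.MathematicalPhysics.QuantumFieldTheory.Balaban1983to89.B13FamilySum (coveringFamilies)
open Literature.MathematicalPhysics.QuantumFieldTheory.Balaban1983to89.T4OutputRate (Carriers)
open Literature.MathematicalPhysics.QuantumFieldTheory.Balaban1983to89.B13Resummation (locE Geometry)
open Summit.QuantumFields.BalabanUV.T4Continuum.B13HistMeasurable (MeasPotFrame B13HistM)
open Summit.QuantumFields.BalabanUV.T4Continuum.B13TermParamGaussianBi (BiCore)
open Summit.QuantumFields.BalabanUV.T4Continuum.NE1p.DressedSmallFieldLabelCountsMu (muPart_locE_le_of_coresAt_pencil_outerLabels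
  muPart_locE_le_of_coresAt_pencil_components)
open Summit.QuantumFields.BalabanUV.T4Continuum.NE1p.DressedSmallFieldComponentSets (memberSetSum_le_of_anchor)
open Summit.QuantumFields.BalabanUV.T4Continuum.NE1p.DressedSmallFieldComponentInner (innerSum_le_of_innerCount)

variable {C : Carriers} {P : MeasPotFrame C} {Op : Type*} [NormedAddCommGroup Op] [NormedSpace ℂ Op] {Dk : LocDomainSys}
  {CubeK : Type} [DecidableEq CubeK]
variable (D : LocDomainSys) {Cube : Type} [DecidableEq Cube] (G : Geometry D Cube) (Gk : Geometry Dk CubeK)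

/-! ## §1 THE μ-TWIN OF S41.1's SET-VALUED END (nonempty sets of anchored components per member; `hinner` DISPLAYED in N0u's SHAPE) -/

section Sets

variable {ι₀ : Type}
  {𝒴 : ℕ → (Σ _ : Finset Cube, Σ F : Finset D.Dom, ∀ Z ∈ F, Finset (Σ _ : Dk.Dom, ι₀)) → Type*}
  {dom : ∀ k i, 𝒴 k i → C.Dom}
  {β : ℕ → (Σ _ : Finset Cube, Σ F : Finset D.Dom, ∀ Z ∈ F, Finset (Σ _ : Dk.Dom, ι₀)) → Type*}
  [∀ k i, MeasurableSpace (β k i)]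
  {α : ℕ → (Σ _ : Finset Cube, Σ F : Finset D.Dom, ∀ Z ∈ F, Finset (Σ _ : Dk.Dom, ι₀)) → Type*}
  [∀ k i, NormedAddCommGroup (α k i)] [∀ k i, InnerProductSpace ℝ (α k i)] [∀ k i, FiniteDimensional ℝ (α k i)]
  [∀ k i, MeasurableSpace (α k i)] [∀ k i, BorelSpace (α k i)]

open Classical in
/-- **THE μ-PART (SOURCE PENCIL `h₀ + s • v`, `‖s‖ < μ₁`) FOR CORES INDEXED BY OUTER LABELS WHOSE INNER DATA ARE NONEMPTY SETS OF ANCHORED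
COMPONENTS WITH INNER LABELS, THE COUNT DISCHARGED** (kernel; N0x PART 2's `muPart_locE_le_of_coresAt_pencil_outerLabels` ONCE BY NAME
with inner data `κ Z′ := Finset (Σ _ : Dk.Dom, ι₀)` — print's components `Z_i`, n ≥ 1 of them determining one `Z′_i`, each with one of
its inner labels —, inner finsets `J Z′ :=` the NONEMPTY subsets of `(univ.filter (cl · = Z′)).sigma I`, weights `Π_{j∈T} ε·m j.1 j.2`, and
`hmember` SUPPLIED by S41.1 §2's `memberSetSum_le_of_anchor` (N0w's `memberSum_le_of_anchor` ∘ `Π(1+w) − 1 ≤ x·eˣ`) — the source-pencil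
twin of S41.1's `attachedPart_locE_le_of_coresAt_pencil_componentSets`.  Binders = that END's VERBATIM under N0x P2's swap (`v`∕`μ₁`∕
`μ₀`∕`sμ`∕`A`∕`hA`∕`h0`∕`h01`∕`hμ` for `w`∕`ϱ`∕`A₀`∕`A₁`∕`hA₀`∕`hA₁`∕`hϱ`∕`hϱA`; weight `vW`, anchor bound `hA'`); `hinner` N0u's SHAPE
displayed, `hanchor`∕`hA'`, `htransfer`, `hκR`∕`hrate2`, N0v's `hlink`∕`hRR`, `hadm` with the NONEMPTY-SUBSET clause, (2.29) clause
`h229` at the amplitude `A·e^{5R}·e^{A}`, `A := ε·e^{c₀}·Aₐ·Gk.K₀`; the source enters ONLY `hH`, `hact`, `hAmp`.  For `0 < μ₀ < μ₁`,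
`‖sμ‖ ≤ μ₀`: `‖E[act sμ](X₀) − E[act 0](X₀)‖ ≤ (e ν c₁ K₀²·A·e^{−r₁ d(X₀)})·μ₀∕(μ₁ − μ₀)`. [folklore] -/
theorem muPart_locE_le_of_coresAt_pencil_componentSets {Win : Set (ℕ → ℝ)}
    {ctr : ℕ → (ℕ → ℝ) → C.BgB → Op × B13HistM P} {ROp RHist R' : ℕ → ℝ}
    (𝔊 : ∀ k i, C.Dom → BiCore P (dom k i) Op (β k i) (α k i))
    {mq bq N₀ : ℕ → (Σ _ : Finset Cube, Σ F : Finset D.Dom, ∀ Z ∈ F, Finset (Σ _ : Dk.Dom, ι₀)) → C.Dom → ℝ}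
    (hroom : ∀ k, ROp k < R' k)
    (hm : ∀ k, ∀ g ∈ Win, ∀ (U : C.BgB) (X : C.Dom), C.scale X = k → ∀ i, 0 < mq k i X)
    (hN : ∀ k, ∀ g ∈ Win, ∀ (U : C.BgB) (X : C.Dom), C.scale X = k → ∀ i,
      (∀ o ∈ ball (ctr k g U).1 (R' k), AEStronglyMeasurable ((𝔊 k i X).N o) (𝔊 k i X).lam) ∧
      (∀ p, DifferentiableOn ℂ (fun o => (𝔊 k i X).N o p) (ball (ctr k g U).1 (R' k))) ∧
      (∀ o ∈ ball (ctr k g U).1 (R' k), ∀ p, ‖(𝔊 k i X).N o p‖ ≤ N₀ k i X))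
    (hq : ∀ k, ∀ g ∈ Win, ∀ (U : C.BgB) (X : C.Dom), C.scale X = k → ∀ i,
      (∀ o ∈ ball (ctr k g U).1 (R' k),
        AEStronglyMeasurable (Function.uncurry ((𝔊 k i X).q o)) ((𝔊 k i X).lam.prod volume)) ∧
      (∀ p v, DifferentiableOn ℂ (fun o => (𝔊 k i X).q o p v) (ball (ctr k g U).1 (R' k))) ∧
      (∀ o ∈ ball (ctr k g U).1 (R' k), ∀ p v, mq k i X * ‖v‖ ^ 2 - bq k i X ≤ ((𝔊 k i X).q o p v).re))
    {k : ℕ} {g : ℕ → ℝ} (hg : g ∈ Win) {U : C.BgB} {o : Op} {h₀ v : B13HistM P} {μ₁ : ℝ}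
    (hO : ‖o - (ctr k g U).1‖ ≤ ROp k) (hH : ‖h₀ - (ctr k g U).2‖ + μ₁ * ‖v‖ ≤ RHist k)
    {emb : D.Dom → C.Dom} (hscale : ∀ Z, C.scale (emb Z) = k)
    {terms : D.Dom → Finset (Σ _ : Finset Cube, Σ F : Finset D.Dom, ∀ Z ∈ F, Finset (Σ _ : Dk.Dom, ι₀))}
    {act : ℂ → D.Dom → ℂ}
    (hact : ∀ σ ∈ ball (0 : ℂ) μ₁, ∀ Z, act σ Z = ∑ i ∈ terms Z, (𝔊 k i (emb Z)).termAt o (h₀ + σ • v))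
    {A Rkp r₁ b₅ μ₀ : ℝ} {X₀ : D.Dom} {sμ : ℂ} (hA : 0 ≤ A) (hr₁ : 0 ≤ r₁) (hb : r₁ * 5 ≤ b₅)
    (hrate : r₁ + 2 * G.κ₀ + 2 ≤ Rkp) (hsmall : A * Real.exp (b₅ + 1) * G.K₀ * G.ν * G.c₁ ≤ 1)
    -- the inner data of the components (N0u's currency, displayed SHAPE) and the anchored closure (N0w's letters VERBATIM)
    (I : Dk.Dom → Finset ι₀) (m : Dk.Dom → ι₀ → ℝ) (hm0 : ∀ Z₀ l, 0 ≤ m Z₀ l) (cl : Dk.Dom → D.Dom)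
    (anc : D.Dom → Finset CubeK) {ε c₀ R₀ Aₐ ℓ r R c' vW : ℝ} (hε : 0 ≤ ε) (hvW : 0 ≤ vW)
    (hinner : ∀ Z₀, ∑ l ∈ I Z₀, m Z₀ l ≤ Real.exp c₀ * Real.exp (-(R₀ * Dk.dj Z₀)))
    (hanchor : ∀ Z₀ Z', cl Z₀ = Z' → ∃ c ∈ anc Z', c ∈ Gk.cubes Z₀) (hA' : ∀ Z', ((anc Z').card : ℝ) ≤ Aₐ)
    (htransfer : ∀ Z₀ Z', cl Z₀ = Z' → ℓ * D.dj Z' ≤ Dk.dj Z₀) (hκR : Gk.κ₀ ≤ R₀) (hrate2 : r + R ≤ (R₀ - Gk.κ₀) * ℓ)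
    (hκ : G.κ₀ + 1 ≤ r)
    (h229 : Real.exp 1 * G.K₀ * G.c₁ * (ε * Real.exp c₀ * Aₐ * Gk.K₀ * Real.exp (5 * R) *
      Real.exp (ε * Real.exp c₀ * Aₐ * Gk.K₀)) ≤ 1)
    (hlink : ∀ Z, ∀ W ⊆ G.cubes Z, ∀ F ∈ coveringFamilies Finset.univ G.cubes (G.cubes Z \ W),
      D.dj Z - c' * W.card + 5 ≤ ∑ Z' ∈ F, (D.dj Z' + 5))
    (hRR : Rkp ≤ R - G.c₁ * (vW * Real.exp (R * c')))
    (hadm : ∀ Z, ∀ l ∈ terms Z, l.1 ⊆ G.cubes Z ∧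
      l.2.1 ∈ coveringFamilies Finset.univ G.cubes (G.cubes Z \ l.1) ∧
      ∀ Z' (h : Z' ∈ l.2.1), (l.2.2 Z' h).Nonempty ∧
        l.2.2 Z' h ⊆ ((Finset.univ : Finset Dk.Dom).filter (fun Z₀ => cl Z₀ = Z')).sigma I)
    (hAmp : ∀ Z, G.cubes Z ⊆ G.cubes X₀ → ∀ l ∈ terms Z,
      (𝔊 k l (emb Z)).lam.real univ * ((𝔊 k l (emb Z)).wB * N₀ k l (emb Z) * Real.exp (bq k l (emb Z))) *
          (Real.pi / (mq k l (emb Z) / 2)) ^ (Module.finrank ℝ (α k l) / 2 : ℝ) *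
        Real.exp ((𝔊 k l (emb Z)).N₁ * (‖h₀‖ + μ₁ * ‖v‖)) ≤
      A * (vW ^ l.1.card * ∏ x ∈ l.2.1.attach, ∏ j ∈ l.2.2 x.1 x.2, ε * m j.1 j.2))
    (h0 : 0 < μ₀) (h01 : μ₀ < μ₁) (hμ : ‖sμ‖ ≤ μ₀) :
    ‖locE G.ι G.cubes (act sμ) (G.cubes X₀) - locE G.ι G.cubes (act 0) (G.cubes X₀)‖ ≤
      Real.exp 1 * G.ν * G.c₁ * G.K₀ ^ 2 * A * Real.exp (-(r₁ * D.dj X₀)) * (μ₀ / (μ₁ - μ₀)) := by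
  -- `0 ≤ Aₐ`, `0 ≤ a`, `0 ≤ r`, `0 ≤ R` FOLLOW from the clauses (`hA'` at `X₀`; `hκ`; `hrate`∕`hRR` as in N0v ∕ S41.1)
  have hA0 : (0 : ℝ) ≤ Aₐ := le_trans (Nat.cast_nonneg _) (hA' X₀)
  have ha : 0 ≤ ε * Real.exp c₀ * Aₐ * Gk.K₀ * Real.exp (5 * R) * Real.exp (ε * Real.exp c₀ * Aₐ * Gk.K₀) :=
    mul_nonneg (mul_nonneg (mul_nonneg (mul_nonneg (mul_nonneg hε (Real.exp_pos _).le) hA0) Gk.K₀_nonneg)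
      (Real.exp_pos _).le) (Real.exp_pos _).le
  have hr : 0 ≤ r := by linarith [G.κ₀_nonneg]
  have hcu : 0 ≤ G.c₁ * (vW * Real.exp (R * c')) := mul_nonneg G.c₁_nonneg (by positivity)
  have hR : 0 ≤ R := by linarith [G.κ₀_nonneg]
  exact muPart_locE_le_of_coresAt_pencil_outerLabels D G 𝔊 hroom hm hN hq hg hO hH hscale hact hA hr₁ hb hrate hsmall
    (fun Z' => (((Finset.univ : Finset Dk.Dom).filter (fun Z₀ => cl Z₀ = Z')).sigma I).powerset.filter fun T => T.Nonempty)
    (fun _ T => ∏ j ∈ T, ε * m j.1 j.2) (fun _ T => Finset.prod_nonneg fun j _ => mul_nonneg hε (hm0 _ _)) ha hvW hκ h229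
    (fun Z' => memberSetSum_le_of_anchor Finset.univ Gk.cubes Dk.dj cl anc D.dj I m hm0 hε Gk.K₀_nonneg hr hR Z' (D.dj_nonneg Z')
      (fun Z₀ _ => hinner Z₀) (fun c _ => Gk.ineq126 c) (fun Z₀ _ h => hanchor Z₀ Z' h) (hA' Z')
      (fun Z₀ _ h => htransfer Z₀ Z' h) hκR hrate2)
    hlink hRR
    (fun Z l hl => ⟨(hadm Z l hl).1, (hadm Z l hl).2.1, fun Z' h =>
      Finset.mem_filter.2 ⟨Finset.mem_powerset.2 ((hadm Z l hl).2.2 Z' h).2, ((hadm Z l hl).2.2 Z' h).1⟩⟩)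
    hAmp h0 h01 hμ

end Sets

/-! ## §2 THE μ-TWIN OF S41.2's COMPOSED END (one anchored component per member, its N0u labels; `hinner` SUPPLIED by S41.2 §1) -/

section Single

variable {Bnd : Type} [DecidableEq Bnd]
  {𝒴 : ℕ → (Σ _ : Finset Cube, Σ F : Finset D.Dom, ∀ Z ∈ F,
    (Σ _ : Dk.Dom, (Σ _ : Finset CubeK, Finset Dk.Dom × Finset Bnd))) → Type*} {dom : ∀ k i, 𝒴 k i → C.Dom}
  {β : ℕ → (Σ _ : Finset Cube, Σ F : Finset D.Dom, ∀ Z ∈ F,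
    (Σ _ : Dk.Dom, (Σ _ : Finset CubeK, Finset Dk.Dom × Finset Bnd))) → Type*} [∀ k i, MeasurableSpace (β k i)]
  {α : ℕ → (Σ _ : Finset Cube, Σ F : Finset D.Dom, ∀ Z ∈ F,
    (Σ _ : Dk.Dom, (Σ _ : Finset CubeK, Finset Dk.Dom × Finset Bnd))) → Type*} [∀ k i, NormedAddCommGroup (α k i)]
  [∀ k i, InnerProductSpace ℝ (α k i)] [∀ k i, FiniteDimensional ℝ (α k i)] [∀ k i, MeasurableSpace (α k i)]
  [∀ k i, BorelSpace (α k i)]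

open Classical in
/-- **THE μ-PART (SOURCE PENCIL) FOR N0w's CORES WITH THE COMPONENTS' INNER COUNTS COMPOSED FROM N0u** (kernel; N0x PART 2's
`muPart_locE_le_of_coresAt_pencil_components` ONCE BY NAME at the inner-label type `Σ _ : Finset CubeK, Finset Dk.Dom × Finset Bnd` —
N0u's `⟨W, (𝐃, P)⟩` —, `I Z₀ :=` N0u's admissible labels WRITTEN OUT (`W ⊆ Gk.cubes Z₀`, `𝐃` covering `Gk.cubes Z₀ ∖ W` exactly,
`P ⊆ bondsOf W`, `#W ≤ 2·#P`), `m :=` N0u's table-blind majorant, `c₀ := Gk.c₁u_k − 5R_k`, `R₀ := R_k − Gk.c₁u_k`, and `hinner` SUPPLIED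
by S41.2 §1 `innerSum_le_of_innerCount` (N0u's `innerCount_le_decay` + b13's `ineq229_locDomainSys` BY NAME) — the source-pencil twin
of S41.2's `attachedPart_locE_le_of_coresAt_pencil_components_inner`: THE WHOLE (B3-count) — 𝐃-step, Y₀∕P-step, components∕{Z′_i}-step,
Z∖Z′₀-step — as ONE kernel implication in which the source (`μ₁`, `μ₀`, `sμ`, direction `v`) occurs ONLY in `hH`, `hact`, `hAmp` and the
conclusion.  DISPLAYED of printed KIND: N0u's (2.27)∘(2.32) link `hlinkk` per component, N0v's (2.27)∘(2.37) link `hlink`, N0w's anchor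
`hanchor`∕`hA'` and (2.36) transfer `htransfer`; the READING data `cl`∕`anc`∕`bondsOf`∕`hadm`; the (2.29) clauses at both scales
(`h229k`, `h229` at N0w's amplitude `ε·e^{Gk.c₁u_k − 5R_k}·Aₐ·Gk.K₀·e^{5R}`); the rate bookkeeping `hκR`∕`hrate2`; `0 ≤ R_k` DERIVED from
`hκR`.  Binders = S41.2's VERBATIM under N0x P2's swap. [folklore] -/
theorem muPart_locE_le_of_coresAt_pencil_components_inner {Win : Set (ℕ → ℝ)}
    {ctr : ℕ → (ℕ → ℝ) → C.BgB → Op × B13HistM P} {ROp RHist R' : ℕ → ℝ}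
    (𝔊 : ∀ k i, C.Dom → BiCore P (dom k i) Op (β k i) (α k i))
    {mq bq N₀ : ℕ → (Σ _ : Finset Cube, Σ F : Finset D.Dom, ∀ Z ∈ F,
      (Σ _ : Dk.Dom, (Σ _ : Finset CubeK, Finset Dk.Dom × Finset Bnd))) → C.Dom → ℝ}
    (hroom : ∀ k, ROp k < R' k)
    (hm : ∀ k, ∀ g ∈ Win, ∀ (U : C.BgB) (X : C.Dom), C.scale X = k → ∀ i, 0 < mq k i X)
    (hN : ∀ k, ∀ g ∈ Win, ∀ (U : C.BgB) (X : C.Dom), C.scale X = k → ∀ i,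
      (∀ o ∈ ball (ctr k g U).1 (R' k), AEStronglyMeasurable ((𝔊 k i X).N o) (𝔊 k i X).lam) ∧
      (∀ p, DifferentiableOn ℂ (fun o => (𝔊 k i X).N o p) (ball (ctr k g U).1 (R' k))) ∧
      (∀ o ∈ ball (ctr k g U).1 (R' k), ∀ p, ‖(𝔊 k i X).N o p‖ ≤ N₀ k i X))
    (hq : ∀ k, ∀ g ∈ Win, ∀ (U : C.BgB) (X : C.Dom), C.scale X = k → ∀ i,
      (∀ o ∈ ball (ctr k g U).1 (R' k),
        AEStronglyMeasurable (Function.uncurry ((𝔊 k i X).q o)) ((𝔊 k i X).lam.prod volume)) ∧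
      (∀ p v, DifferentiableOn ℂ (fun o => (𝔊 k i X).q o p v) (ball (ctr k g U).1 (R' k))) ∧
      (∀ o ∈ ball (ctr k g U).1 (R' k), ∀ p v, mq k i X * ‖v‖ ^ 2 - bq k i X ≤ ((𝔊 k i X).q o p v).re))
    {k : ℕ} {g : ℕ → ℝ} (hg : g ∈ Win) {U : C.BgB} {o : Op} {h₀ v : B13HistM P} {μ₁ : ℝ}
    (hO : ‖o - (ctr k g U).1‖ ≤ ROp k) (hH : ‖h₀ - (ctr k g U).2‖ + μ₁ * ‖v‖ ≤ RHist k)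
    {emb : D.Dom → C.Dom} (hscale : ∀ Z, C.scale (emb Z) = k)
    {terms : D.Dom → Finset (Σ _ : Finset Cube, Σ F : Finset D.Dom, ∀ Z ∈ F,
      (Σ _ : Dk.Dom, (Σ _ : Finset CubeK, Finset Dk.Dom × Finset Bnd)))} {act : ℂ → D.Dom → ℂ}
    (hact : ∀ σ ∈ ball (0 : ℂ) μ₁, ∀ Z, act σ Z = ∑ i ∈ terms Z, (𝔊 k i (emb Z)).termAt o (h₀ + σ • v))
    {A Rkp r₁ b₅ μ₀ : ℝ} {X₀ : D.Dom} {sμ : ℂ} (hA : 0 ≤ A) (hr₁ : 0 ≤ r₁) (hb : r₁ * 5 ≤ b₅)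
    (hrate : r₁ + 2 * G.κ₀ + 2 ≤ Rkp) (hsmall : A * Real.exp (b₅ + 1) * G.K₀ * G.ν * G.c₁ ≤ 1)
    -- scale `k`: N0u's letters and clauses (per component)
    (bondsOf : Finset CubeK → Finset Bnd) {δ κ α₆ Rk c₃₂ b₀ s t : ℝ}
    (hα₆ : 0 ≤ α₆) (hκk : Gk.κ₀ + 1 ≤ δ * κ) (h229k : Real.exp 1 * Gk.K₀ * Gk.c₁ * α₆ ≤ 1)
    (hs0 : 0 ≤ s) (hs1 : s ≤ 1) (ht : 0 ≤ t) (hb₀ : ∀ W, ((bondsOf W).card : ℝ) ≤ b₀ * W.card)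
    (hlinkk : ∀ Z₀ : Dk.Dom, ∀ W ⊆ Gk.cubes Z₀, ∀ Df ∈ coveringFamilies Finset.univ Gk.cubes (Gk.cubes Z₀ \ W),
      Dk.dj Z₀ + 5 ≤ ∑ Y ∈ Df, (Dk.dj Y + 5) + c₃₂ * W.card)
    -- N0w's anchored closure and N0v's letters
    (cl : Dk.Dom → D.Dom) (anc : D.Dom → Finset CubeK) {ε Aₐ ℓ r R c' vW : ℝ} (hε : 0 ≤ ε) (hvW : 0 ≤ vW)
    (hanchor : ∀ Z₀ Z', cl Z₀ = Z' → ∃ c ∈ anc Z', c ∈ Gk.cubes Z₀) (hA' : ∀ Z', ((anc Z').card : ℝ) ≤ Aₐ)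
    (htransfer : ∀ Z₀ Z', cl Z₀ = Z' → ℓ * D.dj Z' ≤ Dk.dj Z₀)
    (hκR : Gk.κ₀ ≤ Rk - Gk.c₁ * (Real.exp (Rk * c₃₂) * s * Real.exp (b₀ * t)))
    (hrate2 : r + R ≤ (Rk - Gk.c₁ * (Real.exp (Rk * c₃₂) * s * Real.exp (b₀ * t)) - Gk.κ₀) * ℓ)
    (hκ : G.κ₀ + 1 ≤ r)
    (h229 : Real.exp 1 * G.K₀ * G.c₁ *
      (ε * Real.exp (Gk.c₁ * (Real.exp (Rk * c₃₂) * s * Real.exp (b₀ * t)) - 5 * Rk) * Aₐ * Gk.K₀ * Real.exp (5 * R)) ≤ 1)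
    (hlink : ∀ Z, ∀ W ⊆ G.cubes Z, ∀ F ∈ coveringFamilies Finset.univ G.cubes (G.cubes Z \ W),
      D.dj Z - c' * W.card + 5 ≤ ∑ Z' ∈ F, (D.dj Z' + 5))
    (hRR : Rkp ≤ R - G.c₁ * (vW * Real.exp (R * c')))
    (hadm : ∀ Z, ∀ l ∈ terms Z, l.1 ⊆ G.cubes Z ∧
      l.2.1 ∈ coveringFamilies Finset.univ G.cubes (G.cubes Z \ l.1) ∧
      ∀ Z' (h : Z' ∈ l.2.1), l.2.2 Z' h ∈ ((Finset.univ : Finset Dk.Dom).filter (fun Z₀ => cl Z₀ = Z')).sigma fun Z₀ =>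
        (Gk.cubes Z₀).powerset.sigma fun W => coveringFamilies Finset.univ Gk.cubes (Gk.cubes Z₀ \ W) ×ˢ
          (bondsOf W).powerset.filter fun P => W.card ≤ 2 * P.card)
    (hAmp : ∀ Z, G.cubes Z ⊆ G.cubes X₀ → ∀ l ∈ terms Z,
      (𝔊 k l (emb Z)).lam.real univ * ((𝔊 k l (emb Z)).wB * N₀ k l (emb Z) * Real.exp (bq k l (emb Z))) *
          (Real.pi / (mq k l (emb Z) / 2)) ^ (Module.finrank ℝ (α k l) / 2 : ℝ) *
        Real.exp ((𝔊 k l (emb Z)).N₁ * (‖h₀‖ + μ₁ * ‖v‖)) ≤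
      A * (vW ^ l.1.card * ∏ x ∈ l.2.1.attach, (ε *
        ((∏ Y ∈ (l.2.2 x.1 x.2).2.2.1, (α₆ * Real.exp (-(δ * κ * Dk.dj Y)) * Real.exp (-(Rk * (Dk.dj Y + 5))))) *
          (s ^ 2 * t) ^ (l.2.2 x.1 x.2).2.2.2.card))))
    (h0 : 0 < μ₀) (h01 : μ₀ < μ₁) (hμ : ‖sμ‖ ≤ μ₀) :
    ‖locE G.ι G.cubes (act sμ) (G.cubes X₀) - locE G.ι G.cubes (act 0) (G.cubes X₀)‖ ≤
      Real.exp 1 * G.ν * G.c₁ * G.K₀ ^ 2 * A * Real.exp (-(r₁ * D.dj X₀)) * (μ₀ / (μ₁ - μ₀)) :=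
  have hcu : 0 ≤ Gk.c₁ * (Real.exp (Rk * c₃₂) * s * Real.exp (b₀ * t)) := mul_nonneg Gk.c₁_nonneg (by positivity)
  have hR : 0 ≤ Rk := by linarith [Gk.κ₀_nonneg]
  muPart_locE_le_of_coresAt_pencil_components D G Gk 𝔊 hroom hm hN hq hg hO hH hscale hact hA hr₁ hb hrate hsmall
    (fun Z₀ => (Gk.cubes Z₀).powerset.sigma fun W => coveringFamilies Finset.univ Gk.cubes (Gk.cubes Z₀ \ W) ×ˢ
      (bondsOf W).powerset.filter fun P => W.card ≤ 2 * P.card)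
    (fun _ l => (∏ Y ∈ l.2.1, (α₆ * Real.exp (-(δ * κ * Dk.dj Y)) * Real.exp (-(Rk * (Dk.dj Y + 5))))) *
      (s ^ 2 * t) ^ l.2.2.card)
    (fun _ l => mul_nonneg (Finset.prod_nonneg fun Y _ => by positivity) (by positivity)) cl anc hε hvW
    (fun Z₀ => innerSum_le_of_innerCount Gk bondsOf hα₆ hκk h229k hs0 hs1 ht hb₀ hR Z₀ (hlinkk Z₀))
    hanchor hA' htransfer hκR hrate2 hκ h229 hlink hRR hadm hAmp h0 h01 hμ

end Single

/-! ## §3 THE μ-TWIN OF S41.2's SET-VALUED COMPOSED END (nonempty sets of anchored components per member; §1 with S41.2 §1 plugged in) -/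

section SetsInner

variable {Bnd : Type} [DecidableEq Bnd]
  {𝒴 : ℕ → (Σ _ : Finset Cube, Σ F : Finset D.Dom, ∀ Z ∈ F,
    Finset (Σ _ : Dk.Dom, (Σ _ : Finset CubeK, Finset Dk.Dom × Finset Bnd))) → Type*} {dom : ∀ k i, 𝒴 k i → C.Dom}
  {β : ℕ → (Σ _ : Finset Cube, Σ F : Finset D.Dom, ∀ Z ∈ F,
    Finset (Σ _ : Dk.Dom, (Σ _ : Finset CubeK, Finset Dk.Dom × Finset Bnd))) → Type*} [∀ k i, MeasurableSpace (β k i)]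
  {α : ℕ → (Σ _ : Finset Cube, Σ F : Finset D.Dom, ∀ Z ∈ F,
    Finset (Σ _ : Dk.Dom, (Σ _ : Finset CubeK, Finset Dk.Dom × Finset Bnd))) → Type*} [∀ k i, NormedAddCommGroup (α k i)]
  [∀ k i, InnerProductSpace ℝ (α k i)] [∀ k i, FiniteDimensional ℝ (α k i)] [∀ k i, MeasurableSpace (α k i)]
  [∀ k i, BorelSpace (α k i)]

open Classical in
/-- **THE μ-PART (SOURCE PENCIL) FOR S41.1's SET-VALUED CORES WITH THE COMPONENTS' INNER COUNTS COMPOSED FROM N0u** (kernel; §1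
`muPart_locE_le_of_coresAt_pencil_componentSets` ONCE — for every member `Z′_i` a NONEMPTY SET of anchored scale-`k` components each
carrying one of N0u's labels `⟨W, (𝐃, P)⟩` (print p. 19: n ≥ 1 components determining `Z′_i`, KIND) —, with `I`∕`m`∕`c₀`∕`R₀` as in §2
and `hinner` SUPPLIED by S41.2 §1 `innerSum_le_of_innerCount` — the source-pencil twin of S41.2's
`attachedPart_locE_le_of_coresAt_pencil_componentSets_inner`.  DISPLAYED as in §2, with `hadm`'s NONEMPTY-SUBSET clause, `hAmp`'s
set-product majorant and `h229` at S41.1's amplitude `A·e^{5R}·e^{A}`, `A := ε·e^{Gk.c₁u_k − 5R_k}·Aₐ·Gk.K₀`; the source enters ONLY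
`hH`, `hact`, `hAmp` and the conclusion. [folklore] -/
theorem muPart_locE_le_of_coresAt_pencil_componentSets_inner {Win : Set (ℕ → ℝ)}
    {ctr : ℕ → (ℕ → ℝ) → C.BgB → Op × B13HistM P} {ROp RHist R' : ℕ → ℝ}
    (𝔊 : ∀ k i, C.Dom → BiCore P (dom k i) Op (β k i) (α k i))
    {mq bq N₀ : ℕ → (Σ _ : Finset Cube, Σ F : Finset D.Dom, ∀ Z ∈ F,
      Finset (Σ _ : Dk.Dom, (Σ _ : Finset CubeK, Finset Dk.Dom × Finset Bnd))) → C.Dom → ℝ}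
    (hroom : ∀ k, ROp k < R' k)
    (hm : ∀ k, ∀ g ∈ Win, ∀ (U : C.BgB) (X : C.Dom), C.scale X = k → ∀ i, 0 < mq k i X)
    (hN : ∀ k, ∀ g ∈ Win, ∀ (U : C.BgB) (X : C.Dom), C.scale X = k → ∀ i,
      (∀ o ∈ ball (ctr k g U).1 (R' k), AEStronglyMeasurable ((𝔊 k i X).N o) (𝔊 k i X).lam) ∧
      (∀ p, DifferentiableOn ℂ (fun o => (𝔊 k i X).N o p) (ball (ctr k g U).1 (R' k))) ∧
      (∀ o ∈ ball (ctr k g U).1 (R' k), ∀ p, ‖(𝔊 k i X).N o p‖ ≤ N₀ k i X))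
    (hq : ∀ k, ∀ g ∈ Win, ∀ (U : C.BgB) (X : C.Dom), C.scale X = k → ∀ i,
      (∀ o ∈ ball (ctr k g U).1 (R' k),
        AEStronglyMeasurable (Function.uncurry ((𝔊 k i X).q o)) ((𝔊 k i X).lam.prod volume)) ∧
      (∀ p v, DifferentiableOn ℂ (fun o => (𝔊 k i X).q o p v) (ball (ctr k g U).1 (R' k))) ∧
      (∀ o ∈ ball (ctr k g U).1 (R' k), ∀ p v, mq k i X * ‖v‖ ^ 2 - bq k i X ≤ ((𝔊 k i X).q o p v).re))
    {k : ℕ} {g : ℕ → ℝ} (hg : g ∈ Win) {U : C.BgB} {o : Op} {h₀ v : B13HistM P} {μ₁ : ℝ}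
    (hO : ‖o - (ctr k g U).1‖ ≤ ROp k) (hH : ‖h₀ - (ctr k g U).2‖ + μ₁ * ‖v‖ ≤ RHist k)
    {emb : D.Dom → C.Dom} (hscale : ∀ Z, C.scale (emb Z) = k)
    {terms : D.Dom → Finset (Σ _ : Finset Cube, Σ F : Finset D.Dom, ∀ Z ∈ F,
      Finset (Σ _ : Dk.Dom, (Σ _ : Finset CubeK, Finset Dk.Dom × Finset Bnd)))} {act : ℂ → D.Dom → ℂ}
    (hact : ∀ σ ∈ ball (0 : ℂ) μ₁, ∀ Z, act σ Z = ∑ i ∈ terms Z, (𝔊 k i (emb Z)).termAt o (h₀ + σ • v))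
    {A Rkp r₁ b₅ μ₀ : ℝ} {X₀ : D.Dom} {sμ : ℂ} (hA : 0 ≤ A) (hr₁ : 0 ≤ r₁) (hb : r₁ * 5 ≤ b₅)
    (hrate : r₁ + 2 * G.κ₀ + 2 ≤ Rkp) (hsmall : A * Real.exp (b₅ + 1) * G.K₀ * G.ν * G.c₁ ≤ 1)
    -- scale `k`: N0u's letters and clauses (per component)
    (bondsOf : Finset CubeK → Finset Bnd) {δ κ α₆ Rk c₃₂ b₀ s t : ℝ}
    (hα₆ : 0 ≤ α₆) (hκk : Gk.κ₀ + 1 ≤ δ * κ) (h229k : Real.exp 1 * Gk.K₀ * Gk.c₁ * α₆ ≤ 1)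
    (hs0 : 0 ≤ s) (hs1 : s ≤ 1) (ht : 0 ≤ t) (hb₀ : ∀ W, ((bondsOf W).card : ℝ) ≤ b₀ * W.card)
    (hlinkk : ∀ Z₀ : Dk.Dom, ∀ W ⊆ Gk.cubes Z₀, ∀ Df ∈ coveringFamilies Finset.univ Gk.cubes (Gk.cubes Z₀ \ W),
      Dk.dj Z₀ + 5 ≤ ∑ Y ∈ Df, (Dk.dj Y + 5) + c₃₂ * W.card)
    -- N0w's anchored closure and N0v's letters
    (cl : Dk.Dom → D.Dom) (anc : D.Dom → Finset CubeK) {ε Aₐ ℓ r R c' vW : ℝ} (hε : 0 ≤ ε) (hvW : 0 ≤ vW)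
    (hanchor : ∀ Z₀ Z', cl Z₀ = Z' → ∃ c ∈ anc Z', c ∈ Gk.cubes Z₀) (hA' : ∀ Z', ((anc Z').card : ℝ) ≤ Aₐ)
    (htransfer : ∀ Z₀ Z', cl Z₀ = Z' → ℓ * D.dj Z' ≤ Dk.dj Z₀)
    (hκR : Gk.κ₀ ≤ Rk - Gk.c₁ * (Real.exp (Rk * c₃₂) * s * Real.exp (b₀ * t)))
    (hrate2 : r + R ≤ (Rk - Gk.c₁ * (Real.exp (Rk * c₃₂) * s * Real.exp (b₀ * t)) - Gk.κ₀) * ℓ)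
    (hκ : G.κ₀ + 1 ≤ r)
    (h229 : Real.exp 1 * G.K₀ * G.c₁ *
      (ε * Real.exp (Gk.c₁ * (Real.exp (Rk * c₃₂) * s * Real.exp (b₀ * t)) - 5 * Rk) * Aₐ * Gk.K₀ * Real.exp (5 * R) *
        Real.exp (ε * Real.exp (Gk.c₁ * (Real.exp (Rk * c₃₂) * s * Real.exp (b₀ * t)) - 5 * Rk) * Aₐ * Gk.K₀)) ≤ 1)
    (hlink : ∀ Z, ∀ W ⊆ G.cubes Z, ∀ F ∈ coveringFamilies Finset.univ G.cubes (G.cubes Z \ W),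
      D.dj Z - c' * W.card + 5 ≤ ∑ Z' ∈ F, (D.dj Z' + 5))
    (hRR : Rkp ≤ R - G.c₁ * (vW * Real.exp (R * c')))
    (hadm : ∀ Z, ∀ l ∈ terms Z, l.1 ⊆ G.cubes Z ∧
      l.2.1 ∈ coveringFamilies Finset.univ G.cubes (G.cubes Z \ l.1) ∧
      ∀ Z' (h : Z' ∈ l.2.1), (l.2.2 Z' h).Nonempty ∧
        l.2.2 Z' h ⊆ ((Finset.univ : Finset Dk.Dom).filter (fun Z₀ => cl Z₀ = Z')).sigma fun Z₀ =>
          (Gk.cubes Z₀).powerset.sigma fun W => coveringFamilies Finset.univ Gk.cubes (Gk.cubes Z₀ \ W) ×ˢ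
            (bondsOf W).powerset.filter fun P => W.card ≤ 2 * P.card)
    (hAmp : ∀ Z, G.cubes Z ⊆ G.cubes X₀ → ∀ l ∈ terms Z,
      (𝔊 k l (emb Z)).lam.real univ * ((𝔊 k l (emb Z)).wB * N₀ k l (emb Z) * Real.exp (bq k l (emb Z))) *
          (Real.pi / (mq k l (emb Z) / 2)) ^ (Module.finrank ℝ (α k l) / 2 : ℝ) *
        Real.exp ((𝔊 k l (emb Z)).N₁ * (‖h₀‖ + μ₁ * ‖v‖)) ≤
      A * (vW ^ l.1.card * ∏ x ∈ l.2.1.attach, ∏ j ∈ l.2.2 x.1 x.2, (ε *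
        ((∏ Y ∈ j.2.2.1, (α₆ * Real.exp (-(δ * κ * Dk.dj Y)) * Real.exp (-(Rk * (Dk.dj Y + 5))))) *
          (s ^ 2 * t) ^ j.2.2.2.card))))
    (h0 : 0 < μ₀) (h01 : μ₀ < μ₁) (hμ : ‖sμ‖ ≤ μ₀) :
    ‖locE G.ι G.cubes (act sμ) (G.cubes X₀) - locE G.ι G.cubes (act 0) (G.cubes X₀)‖ ≤
      Real.exp 1 * G.ν * G.c₁ * G.K₀ ^ 2 * A * Real.exp (-(r₁ * D.dj X₀)) * (μ₀ / (μ₁ - μ₀)) :=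
  have hcu : 0 ≤ Gk.c₁ * (Real.exp (Rk * c₃₂) * s * Real.exp (b₀ * t)) := mul_nonneg Gk.c₁_nonneg (by positivity)
  have hR : 0 ≤ Rk := by linarith [Gk.κ₀_nonneg]
  muPart_locE_le_of_coresAt_pencil_componentSets D G Gk 𝔊 hroom hm hN hq hg hO hH hscale hact hA hr₁ hb hrate hsmall
    (fun Z₀ => (Gk.cubes Z₀).powerset.sigma fun W => coveringFamilies Finset.univ Gk.cubes (Gk.cubes Z₀ \ W) ×ˢ
      (bondsOf W).powerset.filter fun P => W.card ≤ 2 * P.card)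
    (fun _ l => (∏ Y ∈ l.2.1, (α₆ * Real.exp (-(δ * κ * Dk.dj Y)) * Real.exp (-(Rk * (Dk.dj Y + 5))))) *
      (s ^ 2 * t) ^ l.2.2.card)
    (fun _ l => mul_nonneg (Finset.prod_nonneg fun Y _ => by positivity) (by positivity)) cl anc hε hvW
    (fun Z₀ => innerSum_le_of_innerCount Gk bondsOf hα₆ hκk h229k hs0 hs1 ht hb₀ hR Z₀ (hlinkk Z₀))
    hanchor hA' htransfer hκR hrate2 hκ h229 hlink hRR hadm hAmp h0 h01 hμ

end SetsInner

end Summit.QuantumFields.BalabanUV.T4Continuum.NE1p.DressedSmallFieldComponentInnerMu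

end
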